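import Mathlib
import HarnessLib
import Literature.MathematicalPhysics.QuantumLattice.RegionalNumberCharge
import Literature.MathematicalPhysics.QuantumLattice.HubbardModelProofs
import Literature.MathematicalPhysics.QuantumLattice.HubbardHubbardModelEtaODLROProofs

/-!
# Crux `NoOnsiteODLRO` (stmt-HubbardSuperconductivity-0933) — registered stub `stub_pseudospinAlgebra`
# of line `registered` (lead c2): the pseudospin algebra of the staggered density

Census by-product B3 (algebra half). On a finite set of sites `Λ` with a sign `ε : Λ → ℤˣ` put

* `ρ_ε := Σ_x ε_x (n_{x↑} + n_{x↓})` — the staggered density (Zhang's pseudospin `z`-partner of Yang's `η`),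
* `η_ε := etaLower ε = Σ_x ε_x c_{x↓} c_{x↑}`, `η₁ := etaLower 1 = Σ_x c_{x↓} c_{x↑}`,
* `T := hamiltonian G t 0 = -t Σ_{x ∼ y, σ} c†_{xσ} c_{yσ}` — the hopping operator of a graph `G` on `Λ`.

CHARGES under `ρ_ε` (CAR bookkeeping with the regional-number toolkit `RegionalNumberCharge`, the site density
`n_{x↑} + n_{x↓}` being the particle number of the orbital pair `orbs {x}`): the on-site pair annihilator
`c_{y↓} c_{y↑}` has charge `-2 ε_y` (`stagDensity_comm_pairAnnihilation`), the hopping term `c†_{aσ} c_{bτ}`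
charge `ε_a - ε_b` (`stagDensity_comm_hopping`). Consequences:

* **`η_ε ρ_ε - ρ_ε η_ε = 2 η₁`** (`etaLower_comm_stagDensity`; `ε_y² = 1`);
* **`ρρT - 2ρTρ + Tρρ = [ρ, [ρ, T]] = 4T`** whenever `ε` is a bipartite sign for `G` (`ε_x = -ε_y` on edges,
  so every hopping term has charge `±2` and the double commutator multiplies it by `(±2)² = 4`;
  `doubleComm_stagDensity_hamiltonian`) — the `f`-sum operator identity behind the pseudospin ceiling;
* the torus form (`(ℤ/Lℤ)²`, `L` even, `ε = torusStagger`, `T = hubbardTorus 2 L 1 0`): the registered stub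
  `stub_pseudospinAlgebra`.

Sources: S. C. Zhang, PRL 65 (1990) 120 and C. N. Yang, S. C. Zhang, Mod. Phys. Lett. B 4 (1990) 759
(pseudospin `SU(2)`); C. N. Yang, PRL 63 (1989) 2144 (`η` operators); T. Koma, H. Tasaki, J. Stat. Phys. 76
(1994) 745 (double-commutator bookkeeping); O. Bratteli, D. W. Robinson, *Operator Algebras and QSM II* §5.2.2
(CAR charges). Every statement is folklore CAR algebra; no definition is introduced.
-/

noncomputable section

namespace Summit.HubbardSuperconductivity.NoOnsiteODLRO.Pseudospin

open Matrix Finset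
open scoped ComplexOrder
open Literature.Probability.LatticeModels Literature.MathematicalPhysics.QuantumLattice

/-! ### Charge calculus for weighted sums of commuting charges -/

section Ring

variable {n : Type*} [Fintype n]

/-- If `X` has charge `q_a` under each `N_a`, then under the weighted sum `Σ_a c_a N_a` it has charge
`Σ_a c_a q_a`. Bratteli–Robinson II §5.2.2. [folklore] -/
theorem sum_smul_comm_of_comm_eq_smul {α : Type*} (s : Finset α) (N : α → Matrix n n ℂ) (c q : α → ℂ)
    (X : Matrix n n ℂ) (h : ∀ a ∈ s, N a * X - X * N a = q a • X) :
    (∑ a ∈ s, c a • N a) * X - X * ∑ a ∈ s, c a • N a = (∑ a ∈ s, c a * q a) • X := by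
  rw [Finset.sum_mul, Finset.mul_sum, ← Finset.sum_sub_distrib, Finset.sum_smul]
  refine Finset.sum_congr rfl fun a ha => ?_
  rw [Matrix.smul_mul, Matrix.mul_smul, ← smul_sub, h a ha, smul_smul]

/-- The symmetric double commutator `ρρX - 2ρXρ + Xρρ = [ρ, [ρ, X]]` is minus the toolkit's
`ρ(Xρ - ρX) - (Xρ - ρX)ρ`. [folklore] -/
theorem doubleComm_symm_eq_neg (ρ X : Matrix n n ℂ) :
    ρ * (ρ * X) - (2 : ℂ) • (ρ * X * ρ) + X * (ρ * ρ) = -(ρ * (X * ρ - ρ * X) - (X * ρ - ρ * X) * ρ) := by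
  rw [two_smul]
  noncomm_ring

end Ring

/-! ### Charges under the staggered density `ρ_ε = Σ_x ε_x (n_{x↑} + n_{x↓})` -/

section Charges

variable {Λ : Type*} [LinearOrder Λ] [DecidableEq Λ] [Fintype Λ]

/-- The site density is the particle number of the orbital pair at `x`: `n_{x↑} + n_{x↓} = N_{orbs {x}}`.
Bratteli–Robinson II §5.2.2. [folklore] -/
theorem numberOp_add_numberOp_eq_numberDiag (x : Λ) :
    numberOp x 0 + numberOp x 1 = diagonal (fun s : Finset (Orb Λ) => (((s ∩ orbs {x}).card : ℕ) : ℂ)) := by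
  rw [numberDiag_orbs_eq_sum_numberOp, Finset.sum_singleton, Fin.sum_univ_two]

/-- Charge of the on-site pair annihilator `c_{y↓} c_{y↑}` under the site density at `x`: `-2 [y = x]`.
Bratteli–Robinson II §5.2.2. [folklore] -/
theorem siteDensity_comm_pairAnnihilation (x y : Λ) :
    (numberOp x 0 + numberOp x 1) * (annihilation (orb y 1) * annihilation (orb y 0)) -
        annihilation (orb y 1) * annihilation (orb y 0) * (numberOp x 0 + numberOp x 1) =
      (if y = x then (-2 : ℂ) else 0) • (annihilation (orb y 1) * annihilation (orb y 0)) := by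
  -- charge `-[y = x]` of each `c_{yσ}` under `N_{orbs {x}}`, then charges add under products
  have ha : ∀ σ : Fin 2,
      diagonal (fun s : Finset (Orb Λ) => (((s ∩ orbs {x}).card : ℕ) : ℂ)) * annihilation (orb y σ) -
          annihilation (orb y σ) * diagonal (fun s : Finset (Orb Λ) => (((s ∩ orbs {x}).card : ℕ) : ℂ)) =
        (if y = x then (-1 : ℂ) else 0) • annihilation (orb y σ) := by
    intro σ
    rw [numberDiag_comm_annihilation (ι := Orb Λ)]
    congr 1
    by_cases h : y = x <;> simp [h]
  rw [numberOp_add_numberOp_eq_numberDiag, comm_mul_of_comm_eq_smul (ha 1) (ha 0)]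
  congr 1
  by_cases h : y = x <;> norm_num [h]

/-- Charge of the hopping term `c†_{aσ} c_{bτ}` under the site density at `x`: `[a = x] - [b = x]`.
Bratteli–Robinson II §5.2.2. [folklore] -/
theorem siteDensity_comm_hopping (x a b : Λ) (σ τ : Fin 2) :
    (numberOp x 0 + numberOp x 1) * (creation (orb a σ) * annihilation (orb b τ)) -
        creation (orb a σ) * annihilation (orb b τ) * (numberOp x 0 + numberOp x 1) =
      ((if a = x then (1 : ℂ) else 0) - (if b = x then (1 : ℂ) else 0)) •
        (creation (orb a σ) * annihilation (orb b τ)) := by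
  rw [numberOp_add_numberOp_eq_numberDiag, numberDiag_comm_creation_mul_annihilation {x} a b σ τ]
  congr 1
  by_cases ha : a = x <;> by_cases hb : b = x <;> simp [ha, hb]

/-- **Charge of the pair annihilator under the staggered density**:
`ρ_ε (c_{y↓}c_{y↑}) - (c_{y↓}c_{y↑}) ρ_ε = -2ε_y c_{y↓}c_{y↑}`. Zhang, PRL 65 (1990) 120. [folklore] -/
theorem stagDensity_comm_pairAnnihilation (ε : Λ → ℤˣ) (y : Λ) :
    (∑ x : Λ, ((ε x : ℤ) : ℂ) • (numberOp x 0 + numberOp x 1)) *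
          (annihilation (orb y 1) * annihilation (orb y 0)) -
        annihilation (orb y 1) * annihilation (orb y 0) *
          ∑ x : Λ, ((ε x : ℤ) : ℂ) • (numberOp x 0 + numberOp x 1) =
      (-(2 * ((ε y : ℤ) : ℂ))) • (annihilation (orb y 1) * annihilation (orb y 0)) := by
  rw [sum_smul_comm_of_comm_eq_smul Finset.univ _ _ (fun x => if y = x then (-2 : ℂ) else 0) _
      (fun x _ => siteDensity_comm_pairAnnihilation x y)]
  congr 1
  simp only [mul_ite, mul_zero, Finset.sum_ite_eq, Finset.mem_univ, if_true]
  ring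

/-- **Charge of a hopping term under the staggered density**:
`ρ_ε (c†_{aσ}c_{bτ}) - (c†_{aσ}c_{bτ}) ρ_ε = (ε_a - ε_b) c†_{aσ}c_{bτ}`. Zhang, PRL 65 (1990) 120. [folklore] -/
theorem stagDensity_comm_hopping (ε : Λ → ℤˣ) (a b : Λ) (σ τ : Fin 2) :
    (∑ x : Λ, ((ε x : ℤ) : ℂ) • (numberOp x 0 + numberOp x 1)) *
          (creation (orb a σ) * annihilation (orb b τ)) -
        creation (orb a σ) * annihilation (orb b τ) *
          ∑ x : Λ, ((ε x : ℤ) : ℂ) • (numberOp x 0 + numberOp x 1) =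
      (((ε a : ℤ) : ℂ) - ((ε b : ℤ) : ℂ)) • (creation (orb a σ) * annihilation (orb b τ)) := by
  rw [sum_smul_comm_of_comm_eq_smul Finset.univ _ _
      (fun x => (if a = x then (1 : ℂ) else 0) - (if b = x then (1 : ℂ) else 0)) _
      (fun x _ => siteDensity_comm_hopping x a b σ τ)]
  congr 1
  simp only [mul_sub, mul_ite, mul_one, mul_zero, Finset.sum_sub_distrib, Finset.sum_ite_eq,
    Finset.mem_univ, if_true]

end Charges

/-! ### The two pseudospin identities -/

section Identities

variable {Λ : Type*} [LinearOrder Λ] [Fintype Λ]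

/-- **`[η_ε, ρ] = 2η₁`** for every operator `ρ` under which each pair annihilator `c_{y↓}c_{y↑}` has charge
`-2ε_y` (e.g. the staggered density `ρ_ε`): `η_ε ρ - ρ η_ε = 2 η₁`, `η₁ = etaLower 1` (`ε_y² = 1`).
Zhang, PRL 65 (1990) 120; Yang, PRL 63 (1989) 2144, eq. (4). [folklore] -/
theorem etaLower_comm_of_charges (ρ : Matrix (Finset (Orb Λ)) (Finset (Orb Λ)) ℂ) (ε : Λ → ℤˣ)
    (hc : ∀ y : Λ, ρ * (annihilation (orb y 1) * annihilation (orb y 0)) -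
        annihilation (orb y 1) * annihilation (orb y 0) * ρ =
      (-(2 * ((ε y : ℤ) : ℂ))) • (annihilation (orb y 1) * annihilation (orb y 0))) :
    etaLower ε * ρ - ρ * etaLower ε = (2 : ℂ) • etaLower (fun _ : Λ => (1 : ℤˣ)) := by
  rw [EtaPairingODLRO.etaLower_eq_sum' ε, EtaPairingODLRO.etaLower_eq_sum' (fun _ : Λ => (1 : ℤˣ)),
    Finset.sum_mul, Finset.mul_sum, ← Finset.sum_sub_distrib, Finset.smul_sum]
  refine Finset.sum_congr rfl fun y _ => ?_
  rw [Matrix.smul_mul, Matrix.mul_smul, ← smul_sub, ← neg_sub, hc y, smul_neg, ← neg_smul, smul_smul,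
    smul_smul, Units.val_one, Int.cast_one, mul_one]
  congr 1
  have he : ((ε y : ℤ) : ℂ) * ((ε y : ℤ) : ℂ) = 1 := by
    rw [← Int.cast_mul, ← Units.val_mul, Int.units_mul_self, Units.val_one, Int.cast_one]
  linear_combination (2 : ℂ) * he

variable (G : SimpleGraph Λ) [DecidableRel G.Adj]

/-- **`[ρ, [ρ, T]] = 4T`** for the hopping operator `T = hamiltonian G t 0` and every operator `ρ` under which
each hopping term `c†_{aσ}c_{bσ}` has charge `q_a - q_b` with `(q_a - q_b)² = 4` across every edge (e.g. the
staggered density of a bipartite sign, charges `ε_a - ε_b = ±2`): `ρρT - 2ρTρ + Tρρ = 4T`.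
Zhang, PRL 65 (1990) 120; Koma–Tasaki, J. Stat. Phys. 76 (1994) 745. [folklore] -/
theorem doubleComm_hamiltonian_of_charges (ρ : Matrix (Finset (Orb Λ)) (Finset (Orb Λ)) ℂ) (q : Λ → ℂ)
    (hc : ∀ (a b : Λ) (σ : Fin 2), ρ * (creation (orb a σ) * annihilation (orb b σ)) -
        creation (orb a σ) * annihilation (orb b σ) * ρ =
      (q a - q b) • (creation (orb a σ) * annihilation (orb b σ)))
    (hq : ∀ a b : Λ, G.Adj a b → (q a - q b) ^ 2 = 4) (t : ℝ) :
    ρ * (ρ * hamiltonian G t 0) - (2 : ℂ) • (ρ * hamiltonian G t 0 * ρ) + hamiltonian G t 0 * (ρ * ρ) =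
      (4 : ℂ) • hamiltonian G t 0 := by
  rw [doubleComm_symm_eq_neg]
  -- hopping terms: charge `q_a - q_b`, squared `4` across an edge
  have hhop : ∀ (x y : Λ) (σ : Fin 2),
      ρ * ((if G.Adj x y then creation (orb x σ) * annihilation (orb y σ) else 0) * ρ -
          ρ * (if G.Adj x y then creation (orb x σ) * annihilation (orb y σ) else 0)) -
        ((if G.Adj x y then creation (orb x σ) * annihilation (orb y σ) else 0) * ρ -
          ρ * (if G.Adj x y then creation (orb x σ) * annihilation (orb y σ) else 0)) * ρ =
      -((4 : ℂ) • (if G.Adj x y then creation (orb x σ) * annihilation (orb y σ) else 0)) := by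
    intro x y σ
    by_cases hxy : G.Adj x y
    · simp only [if_pos hxy]
      rw [doubleComm_of_comm_eq_smul (hc x y σ), hq x y hxy]
    · simp only [if_neg hxy, Matrix.mul_zero, Matrix.zero_mul, sub_self, smul_zero, neg_zero]
  have hT : hamiltonian G t 0 =
      -(t : ℂ) • ∑ x : Λ, ∑ y : Λ, ∑ σ : Fin 2,
        (if G.Adj x y then creation (orb x σ) * annihilation (orb y σ) else 0) := by
    rw [hamiltonian, Complex.ofReal_zero, zero_smul, add_zero]
  rw [hT, doubleComm_smul]
  simp only [doubleComm_sum, hhop, Finset.sum_neg_distrib, ← Finset.smul_sum, smul_neg, neg_neg]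
  rw [smul_comm]

end Identities

/-! ### The torus of even side: the registered stub -/

section Torus

/-- **Registered stub `stub_pseudospinAlgebra`** of line `registered` for crux `NoOnsiteODLRO`
(stmt-HubbardSuperconductivity-0933; census by-product B3, NOT a piece of the composition `NoOnsiteODLRO_of`).
On the torus `(ℤ/Lℤ)²` of even side with the bipartite sign `ε = torusStagger`, the staggered density
`ρ_Q = Σ_x ε_x (n_{x↑} + n_{x↓})`, Yang's `η = etaLower torusStagger`, `η₁ = etaLower 1` and the hopping operator
`T = hubbardTorus 2 L 1 0` satisfy the pseudospin relations
`η ρ_Q - ρ_Q η = 2 η₁` and `ρ_Q ρ_Q T - 2 ρ_Q T ρ_Q + T ρ_Q ρ_Q = 4 T`.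
Zhang, PRL 65 (1990) 120; Yang–Zhang, Mod. Phys. Lett. B 4 (1990) 759; Yang, PRL 63 (1989) 2144. [folklore] -/
theorem stub_pseudospinAlgebra :
    ∀ (L : ℕ) [NeZero L], Even L →
      (etaLower torusStagger *
            (∑ x : FermionTorus 2 L, ((torusStagger x : ℤ) : ℂ) • (numberOp x 0 + numberOp x 1)) -
          (∑ x : FermionTorus 2 L, ((torusStagger x : ℤ) : ℂ) • (numberOp x 0 + numberOp x 1)) *
            etaLower torusStagger =
        (2 : ℂ) • etaLower (fun _ : FermionTorus 2 L => (1 : ℤˣ))) ∧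
      ((∑ x : FermionTorus 2 L, ((torusStagger x : ℤ) : ℂ) • (numberOp x 0 + numberOp x 1)) *
            ((∑ x : FermionTorus 2 L, ((torusStagger x : ℤ) : ℂ) • (numberOp x 0 + numberOp x 1)) *
              hubbardTorus 2 L 1 0) -
          (2 : ℂ) • ((∑ x : FermionTorus 2 L, ((torusStagger x : ℤ) : ℂ) • (numberOp x 0 + numberOp x 1)) *
              hubbardTorus 2 L 1 0 *
            (∑ x : FermionTorus 2 L, ((torusStagger x : ℤ) : ℂ) • (numberOp x 0 + numberOp x 1))) +
          hubbardTorus 2 L 1 0 *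
            ((∑ x : FermionTorus 2 L, ((torusStagger x : ℤ) : ℂ) • (numberOp x 0 + numberOp x 1)) *
              (∑ x : FermionTorus 2 L, ((torusStagger x : ℤ) : ℂ) • (numberOp x 0 + numberOp x 1))) =
        (4 : ℂ) • hubbardTorus 2 L 1 0) := by
  intro L _ hL
  refine ⟨etaLower_comm_of_charges _ torusStagger (stagDensity_comm_pairAnnihilation torusStagger), ?_⟩
  have hq : ∀ a b : FermionTorus 2 L, (fermionTorusGraph 2 L).Adj a b →
      (((torusStagger a : ℤ) : ℂ) - ((torusStagger b : ℤ) : ℂ)) ^ 2 = 4 := by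
    intro a b hab
    rw [torusStagger_eq_neg_of_adj_holds hL hab, Units.val_neg, Int.cast_neg]
    have he : ((torusStagger b : ℤ) : ℂ) * ((torusStagger b : ℤ) : ℂ) = 1 := by
      rw [← Int.cast_mul, ← Units.val_mul, Int.units_mul_self, Units.val_one, Int.cast_one]
    linear_combination (4 : ℂ) * he
  exact doubleComm_hamiltonian_of_charges (fermionTorusGraph 2 L) _ (fun x => ((torusStagger x : ℤ) : ℂ))
    (fun a b σ => stagDensity_comm_hopping torusStagger a b σ σ) hq 1

end Torus

end Summit.HubbardSuperconductivity.NoOnsiteODLRO.Pseudospin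

end
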